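import Summits.ABC.ABC.Theses.FeketeScales
import Summits.ABC.ABC.Theorems.FeketeScalesAssembly
import Summits.ABC.ABC.Theorems.FeketeScalesPolynomialAbcOfSubmult
import Literature.NumberTheory.DiophantineGeometry.AbcWave0SUnitProofs
import HarnessLib

/-!
# Crux `SparseGoodScales` (stmt-ABC-2161) — round-2 ideator 4: the MINIMAL in-route residue
# `DroughtsOfSomeRatio` (DA∃) — statements and proofs (no `sorry`)

Companion of `Cruxes/SparseGoodScales/BarrierNotes-r2-k4.md` (obstruction-side notes; NO idea card
is filed this round).  Notation: `SGS` = the crux; `WGS` = windowed good scales and `DA` =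
exceptional-radical droughts of EVERY ratio (round 1, `Cruxes/SparseGoodScales/Lines/Sketch.lean`,
`Ideas/bounded-quality-times-radical-droughts.md`); `2160` = `ScaleSubmultiplicativity`.

NEW STATEMENT.  `DroughtsOfSomeRatio` (DA∃): for every `δ > 0` there is SOME ratio `Λ = Λ(δ) > 1`
such that for infinitely many scales `R` no abc triple with radical in the window `(R^{1/Λ}, R]`
(written `rad ≤ R ∧ R < rad^Λ`) has quality `> 1 + δ` (`c ≤ rad^{1+δ}`).  Equivalently: for no
`δ > 0` are the radicals of the `(1+δ)`-exceptional triples log-log-DENSE (consecutive log-ratio → 1).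

Results in this file (all proved, standard axioms):
* `droughtsOfSomeRatio_of_every`      : DA → DA∃                       (`Λ := 2`)
* `droughtsOfSomeRatio_of_windowed`   : WGS → DA∃                      (thin windows)
* `droughtsOfSomeRatio_of_sparseGoodScales` : SGS → DA∃                (thin windows)
* `flat_of_drought` : at a drought scale the record is attained BELOW the window or is `≤ R^{1+δ}`
* `upper_propagation` : the Fekete upgrade from ONE scale with ANY exponent `q`
  (`FeketeScalesAssembly.allScales` with `b = q log S`): `P S (S^q)` at a large scale `S` gives
  `c ≤ e^B rad^{q+2δ}` for every abc triple
* `sparseGoodScales_of_scaleSubmultiplicativity_of_droughts` : **2160 → DA∃ → SGS**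
  (abc.S25 enters through the PROVED `finite_setOf_isABCTriple_primeFactors_subset_holds`)
* `droughtsOfSomeRatio_iff_sparseGoodScales_of_scaleSubmultiplicativity` : 2160 → (DA∃ ↔ SGS).
So DA∃ is the WEAKEST statement in the tree that completes route FeketeScales (strictly weaker than
SGS, WGS, DA even under bounded quality — shape-model in the notes §2), and it needs 2160 at FULL
strength (the flat-stretch/escalation argument below), which the round-1 factorisation through
bounded quality (a corollary of 2160) cannot see.
-/

set_option linter.dupNamespace false

namespace Summit.ABC.ABC.Cruxes.SparseGoodScales.MinimalResidue

open Literature.NumberTheory.DiophantineGeometry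
open Summit.ABC.ABC.Theses.FeketeScales
open Summit.ABC.ABC.Theorems

/-- **DA∃ — droughts of SOME ratio.** For every `δ > 0` there is a ratio `Λ > 1` such that for
every `N` some scale `R ≥ N` has NO abc triple with `rad ≤ R < rad^Λ` and `c > rad^{1+δ}`:
the `(1+δ)`-exceptional radicals omit, infinitely often, a window of the fixed multiplicative
log-ratio `Λ(δ)`. -/
def DroughtsOfSomeRatio : Prop :=
  ∀ δ : ℝ, 0 < δ → ∃ Λ : ℝ, 1 < Λ ∧ ∀ N : ℕ, ∃ R : ℕ, N ≤ R ∧ ∀ a b c : ℕ, IsABCTriple a b c →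
    rad a b c ≤ R → (R : ℝ) < ((rad a b c : ℕ) : ℝ) ^ Λ → (c : ℝ) ≤ ((rad a b c : ℕ) : ℝ) ^ (1 + δ)

/-- **DA — droughts of EVERY ratio** (round 1, `ExceptionalRadicalDroughts` / `RadicalLacunarity`). -/
def DroughtsOfEveryRatio : Prop :=
  ∀ δ : ℝ, 0 < δ → ∀ Λ : ℝ, 1 < Λ → ∀ N : ℕ, ∃ R : ℕ, N ≤ R ∧ ∀ a b c : ℕ, IsABCTriple a b c →
    rad a b c ≤ R → (R : ℝ) < ((rad a b c : ℕ) : ℝ) ^ Λ → (c : ℝ) ≤ ((rad a b c : ℕ) : ℝ) ^ (1 + δ)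

/-- **WGS — windowed good scales** (round 1; the dead line's horizontal stub, verbatim). -/
def WindowedGoodScales : Prop :=
  ∀ δ : ℝ, 0 < δ → ∀ Λ : ℝ, 1 < Λ → ∀ N : ℕ, ∃ R : ℕ, N ≤ R ∧ ∀ a b c : ℕ, IsABCTriple a b c →
    rad a b c ≤ R → (R : ℝ) < ((rad a b c : ℕ) : ℝ) ^ Λ → (c : ℝ) ≤ (R : ℝ) ^ (1 + δ)

/-- DA → DA∃ (take `Λ := 2`). [folklore] -/
theorem droughtsOfSomeRatio_of_every (h : DroughtsOfEveryRatio) : DroughtsOfSomeRatio :=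
  fun δ hδ => ⟨2, one_lt_two, h δ hδ 2 one_lt_two⟩

/-- The thin-window computation: if `R < rad^Λ` with `Λ = (1+δ)/(1+δ/2)` then
`R^{1+δ/2} < rad^{1+δ}`. [folklore] -/
theorem rpow_window_lt {δ : ℝ} (hδ : 0 < δ) {R r : ℝ} (hR : 0 ≤ R) (hr : 0 ≤ r)
    (hw : R < r ^ ((1 + δ) / (1 + δ / 2))) :
    R ^ (1 + δ / 2) < r ^ (1 + δ) := by
  have h1 : 0 < 1 + δ / 2 := by linarith
  have h2 : R ^ (1 + δ / 2) < (r ^ ((1 + δ) / (1 + δ / 2))) ^ (1 + δ / 2) :=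
    Real.rpow_lt_rpow hR hw h1
  have h3 : (r ^ ((1 + δ) / (1 + δ / 2))) ^ (1 + δ / 2) = r ^ (1 + δ) := by
    rw [← Real.rpow_mul hr]
    congr 1
    field_simp
  rwa [h3] at h2

/-- The thin-window ratio `(1+δ)/(1+δ/2)` exceeds `1`. [folklore] -/
theorem one_lt_windowRatio {δ : ℝ} (hδ : 0 < δ) : 1 < (1 + δ) / (1 + δ / 2) := by
  rw [one_lt_div (by linarith)]
  linarith

/-- **SGS → DA∃** (standalone): a `δ/2`-good scale of the crux is a drought scale for quality
`1+δ` on the THIN top window `(R^{(1+δ/2)/(1+δ)}, R]`, i.e. with `Λ(δ) = (1+δ)/(1+δ/2)`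
(round 1's `radicalLacunarity_top_of_sparseGoodScales`, restated for DA∃). [folklore] -/
theorem droughtsOfSomeRatio_of_sparseGoodScales (h : SparseGoodScales) : DroughtsOfSomeRatio := by
  intro δ hδ
  refine ⟨(1 + δ) / (1 + δ / 2), one_lt_windowRatio hδ, fun N => ?_⟩
  obtain ⟨R, hNR, hR⟩ := h (δ / 2) (by linarith) N
  refine ⟨R, hNR, fun a b c habc hrad hwin => ?_⟩
  have hc : (c : ℝ) ≤ (R : ℝ) ^ (1 + δ / 2) := hR a b c habc hrad
  exact hc.trans (rpow_window_lt hδ (Nat.cast_nonneg R) (Nat.cast_nonneg _) hwin).le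

/-- **WGS → DA∃** (standalone): WGS at `(δ/2, Λ(δ))` on the same thin window. [folklore] -/
theorem droughtsOfSomeRatio_of_windowed (h : WindowedGoodScales) : DroughtsOfSomeRatio := by
  intro δ hδ
  refine ⟨(1 + δ) / (1 + δ / 2), one_lt_windowRatio hδ, fun N => ?_⟩
  obtain ⟨R, hNR, hR⟩ := h (δ / 2) (by linarith) _ (one_lt_windowRatio hδ) N
  refine ⟨R, hNR, fun a b c habc hrad hwin => ?_⟩
  have hc : (c : ℝ) ≤ (R : ℝ) ^ (1 + δ / 2) := hR a b c habc hrad hwin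
  exact hc.trans (rpow_window_lt hδ (Nat.cast_nonneg R) (Nat.cast_nonneg _) hwin).le

/-- **Flatness at a drought scale** (the one new move of this round).  If at scale `R` the window
`(R^{1/Λ}, R]` carries no triple of quality `> 1+δ`, and every triple BELOW the window
(`rad^Λ ≤ R`) has `c ≤ Y`, then every triple of radical `≤ R` has `c ≤ max Y R^{1+δ}`: the record
`G(R)` is attained below the window or is `≤ R^{1+δ}`.  With `R` `ε`-bad (`G(R) > R^{1+ε}`,
`ε > δ`) this reads `G(R) = G(R^{1/Λ})`, i.e. `sq(R) = sq(R^{1/Λ})/Λ` — incompatible with the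
Fekete-type upper propagation that `ScaleSubmultiplicativity` provides. [folklore] -/
theorem flat_of_drought {δ Λ Y : ℝ} {R : ℕ} (hδ : 0 ≤ 1 + δ)
    (hD : ∀ a b c : ℕ, IsABCTriple a b c → rad a b c ≤ R → (R : ℝ) < ((rad a b c : ℕ) : ℝ) ^ Λ →
      (c : ℝ) ≤ ((rad a b c : ℕ) : ℝ) ^ (1 + δ))
    (hY : ∀ a b c : ℕ, IsABCTriple a b c → ((rad a b c : ℕ) : ℝ) ^ Λ ≤ R → (c : ℝ) ≤ Y) :
    ∀ a b c : ℕ, IsABCTriple a b c → rad a b c ≤ R → (c : ℝ) ≤ max Y ((R : ℝ) ^ (1 + δ)) := by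
  intro a b c habc hrad
  rcases lt_or_ge (R : ℝ) (((rad a b c : ℕ) : ℝ) ^ Λ) with hwin | hbelow
  · have h1 : (c : ℝ) ≤ ((rad a b c : ℕ) : ℝ) ^ (1 + δ) := hD a b c habc hrad hwin
    have h2 : ((rad a b c : ℕ) : ℝ) ^ (1 + δ) ≤ (R : ℝ) ^ (1 + δ) :=
      Real.rpow_le_rpow (Nat.cast_nonneg _) (by exact_mod_cast hrad) hδ
    exact (h1.trans h2).trans (le_max_right _ _)
  · exact (hY a b c habc hbelow).trans (le_max_left _ _)

/-- **Upper propagation from one scale with an arbitrary exponent** (the Fekete upgrade of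
`FeketeScalesAssembly.abc_of_submult_of_sparseGoodScales`, with the good-scale exponent `1+δ`
replaced by any `q ≥ 0`).  Under the normalised sub-multiplicativity (`0 ≤ θ < 1`, slack
`e^L e^{(log R₁R₂)^θ}`, scales `≥ R₀`) and for every `δ > 0` there is a threshold `T` such that:
if `S ≥ max R₀ 2`, `log S ≥ T` and every abc triple of radical `≤ S` has `c ≤ S^q`, then
`c ≤ e^B rad(abc)^{q+2δ}` for EVERY abc triple, for some real `B`. [folklore] -/
theorem upper_propagation {θ L : ℝ} {R₀ : ℕ} (hθ0 : 0 ≤ θ) (hθ1 : θ < 1) (hL : 0 ≤ L)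
    (hsub : ∀ R₁ R₂ : ℕ, R₀ ≤ R₁ → R₀ ≤ R₂ → ∀ a b c : ℕ, IsABCTriple a b c → rad a b c ≤ R₁ * R₂ →
      ∃ a₁ b₁ c₁ a₂ b₂ c₂ : ℕ, IsABCTriple a₁ b₁ c₁ ∧ rad a₁ b₁ c₁ ≤ R₁ ∧ IsABCTriple a₂ b₂ c₂ ∧
        rad a₂ b₂ c₂ ≤ R₂ ∧
        (c : ℝ) ≤ Real.exp L * Real.exp (Real.log ((R₁ : ℝ) * R₂) ^ θ) * c₁ * c₂)
    {δ : ℝ} (hδ0 : 0 < δ) :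
    ∃ T : ℝ, ∀ (S : ℕ) (q : ℝ), R₀ ≤ S → 2 ≤ S → T ≤ Real.log S → 0 ≤ q →
      (∀ a b c : ℕ, IsABCTriple a b c → rad a b c ≤ S → (c : ℝ) ≤ (S : ℝ) ^ q) →
      ∃ B : ℝ, ∀ a b c : ℕ, IsABCTriple a b c →
        (c : ℝ) ≤ Real.exp B * ((rad a b c : ℕ) : ℝ) ^ (q + 2 * δ) := by
  -- constants attached to `θ`
  have h2θ : (2:ℝ) ^ θ < 2 := by
    have := Real.rpow_lt_rpow_of_exponent_lt (by norm_num : (1:ℝ) < 2) hθ1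
    rwa [Real.rpow_one] at this
  have h2θpos : 0 < (2:ℝ) ^ θ := by positivity
  set κ : ℝ := δ * (2 - (2:ℝ) ^ θ) with hκ
  have hκ0 : 0 < κ := mul_pos hδ0 (by linarith)
  -- a threshold `T` with `L + 2^θ t^θ ≤ κ t` for all `t ≥ T`
  obtain ⟨B₁, hB₁0, hB₁⟩ :=
    FeketeScalesAssembly.rpow_le_linear_add_const hθ0 hθ1 (a := κ / (2 * (2:ℝ) ^ θ))
      (by positivity)
  set T : ℝ := 2 * (L + (2:ℝ) ^ θ * B₁) / κ with hT
  have hT' : κ / 2 * T = L + (2:ℝ) ^ θ * B₁ := by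
    rw [hT]; field_simp
  have hstep1 : ∀ t : ℝ, 0 ≤ t → T ≤ t → L + (2:ℝ) ^ θ * t ^ θ ≤ κ * t := by
    intro t ht hTt
    have h1 := mul_le_mul_of_nonneg_left (hB₁ t ht) h2θpos.le
    have e : (2:ℝ) ^ θ * (κ / (2 * (2:ℝ) ^ θ) * t + B₁) = κ / 2 * t + (2:ℝ) ^ θ * B₁ := by
      field_simp
    have h3 := mul_le_mul_of_nonneg_left hTt (by positivity : (0:ℝ) ≤ κ / 2)
    linarith
  refine ⟨T, fun S q hR₀S hS2 hTS hq0 hP => ?_⟩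
  have hS1 : 1 ≤ S := by omega
  have hSpos : (0:ℝ) < S := by positivity
  have hS1' : (1:ℝ) < S := by exact_mod_cast hS2
  set t : ℝ := Real.log S with ht_def
  have htpos : 0 < t := Real.log_pos hS1'
  -- the constants of `allScales`
  have hβ : L + (2:ℝ) ^ θ * (Real.log S) ^ θ ≤ δ * t * (2 - (2:ℝ) ^ θ) := by
    have := hstep1 t htpos.le hTS
    rw [hκ] at this
    rw [← ht_def]; linarith
  have hβ0 : 0 ≤ δ * t := by positivity
  set φ : ℝ := (1 + θ) / 2 with hφ
  have hθφ : θ ≤ φ := by rw [hφ]; linarith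
  have hφ0 : 0 < φ := by rw [hφ]; linarith
  have hφ1 : φ < 1 := by rw [hφ]; linarith
  have h2φ : (2:ℝ) ^ (-φ) < 1 := Real.rpow_lt_one_of_one_lt_of_neg (by norm_num) (by linarith)
  have htθ : 0 < t ^ θ := Real.rpow_pos_of_pos htpos θ
  set γ : ℝ := (L + t ^ θ) / (1 - (2:ℝ) ^ (-φ)) with hγ_def
  have hγpos : 0 < γ := div_pos (by linarith) (by linarith)
  have hγ : L + (Real.log S) ^ θ ≤ γ * (1 - (2:ℝ) ^ (-φ)) := by
    rw [← ht_def, hγ_def, div_mul_cancel₀ _ (by linarith)]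
  -- the iteration, for the predicate "every abc triple with `rad ≤ S'` has `c ≤ X`"
  have hall := FeketeScalesAssembly.allScales
    (fun (S' : ℕ) (X : ℝ) => ∀ a b c : ℕ, IsABCTriple a b c → rad a b c ≤ S' → (c : ℝ) ≤ X)
    (b := q * t) hθ0 hθφ hL hβ0 hγpos.le hR₀S hS1 hβ hγ
    (fun S' X Y hP' hXY a b c h1 h2 => (hP' a b c h1 h2).trans hXY)
    (by
      intro S₁ S₂ hS₁ hS₂ X₁ X₂ hX₁ hX₂ hP₁ hP₂ a b c habc hrad
      obtain ⟨a₁, b₁, c₁, a₂, b₂, c₂, h₁, hr₁, h₂, hr₂, hc⟩ := hsub S₁ S₂ hS₁ hS₂ a b c habc hrad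
      have hc₁ : (c₁ : ℝ) ≤ X₁ := hP₁ a₁ b₁ c₁ h₁ hr₁
      have hc₂ : (c₂ : ℝ) ≤ X₂ := hP₂ a₂ b₂ c₂ h₂ hr₂
      calc (c : ℝ) ≤ Real.exp L * Real.exp (Real.log ((S₁ : ℝ) * S₂) ^ θ) * c₁ * c₂ := hc
        _ ≤ Real.exp L * Real.exp (Real.log ((S₁ : ℝ) * S₂) ^ θ) * X₁ * X₂ := by gcongr)
    (by
      intro a b c habc hrad
      have := hP a b c habc hrad
      rwa [Real.rpow_def_of_pos hSpos, mul_comm] at this)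
  -- sublinearity of `N ↦ γ N^φ`
  obtain ⟨B₂, hB₂0, hB₂⟩ :=
    FeketeScalesAssembly.rpow_le_linear_add_const hφ0.le hφ1 (a := δ * t / γ) (by positivity)
  set B : ℝ := (q + 2 * δ) * t + γ * B₂ with hB
  refine ⟨B, ?_⟩
  intro a b c habc
  -- the least `N` with `rad ≤ S ^ N`
  set r : ℕ := rad a b c
  have hr2 : 2 ≤ r := habc.two_le_rad
  set N : ℕ := Nat.clog S r
  have hN1 : 1 ≤ N := Nat.clog_pos hS2 hr2
  have hrN : r ≤ S ^ N := Nat.le_pow_clog hS2 r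
  have hlt : S ^ (N - 1) < r := by
    have := Nat.pow_pred_clog_lt_self hS2 (x := r) hr2
    simpa [Nat.pred_eq_sub_one] using this
  have hc : (c : ℝ) ≤ Real.exp (N * (q * t + δ * t) + γ * (N : ℝ) ^ φ) :=
    hall N hN1 a b c habc hrN
  -- `N log S < log r + log S`
  have hr0 : 0 < r := by omega
  have hrpos : (0:ℝ) < r := by exact_mod_cast hr0
  set x : ℝ := Real.log r with hx_def
  have hNt : (N : ℝ) * t < x + t := by
    have h1 : ((S : ℝ)) ^ (N - 1) < r := by exact_mod_cast hlt
    have h2 := Real.log_lt_log (pow_pos hSpos _) h1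
    rw [Real.log_pow, Nat.cast_sub hN1] at h2
    push_cast at h2
    rw [← ht_def, ← hx_def] at h2
    linarith
  -- assemble the exponent bound `≤ (q + 2δ) x + B`
  have hN0 : (0:ℝ) ≤ N := Nat.cast_nonneg N
  have hE1 : (N : ℝ) * (q * t + δ * t) ≤ (q + δ) * (x + t) := by
    have h1 := mul_le_mul_of_nonneg_left hNt.le (by positivity : (0:ℝ) ≤ q + δ)
    have e : (N : ℝ) * (q * t + δ * t) = (q + δ) * ((N : ℝ) * t) := by ring
    rw [e]; exact h1
  have hE2 : γ * (N : ℝ) ^ φ ≤ δ * t * N + γ * B₂ := by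
    have := mul_le_mul_of_nonneg_left (hB₂ N hN0) hγpos.le
    have e : γ * (δ * t / γ * N + B₂) = δ * t * N + γ * B₂ := by field_simp
    linarith
  have hE3 : δ * t * N ≤ δ * (x + t) := by
    have := mul_le_mul_of_nonneg_left hNt.le hδ0.le
    linarith
  have hE : (N : ℝ) * (q * t + δ * t) + γ * (N : ℝ) ^ φ ≤ (q + 2 * δ) * x + B := by
    rw [hB]; linarith
  have hexp : Real.exp ((q + 2 * δ) * x + B) = Real.exp B * (r : ℝ) ^ (q + 2 * δ) := by
    rw [Real.rpow_def_of_pos hrpos, ← Real.exp_add, hx_def]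
    congr 1; ring
  calc (c : ℝ) ≤ Real.exp ((q + 2 * δ) * x + B) := hc.trans (Real.exp_le_exp.2 hE)
    _ = Real.exp B * (r : ℝ) ^ (q + 2 * δ) := hexp

/-- **The reduction: `ScaleSubmultiplicativity → DroughtsOfSomeRatio → SparseGoodScales`.**

Proof (finitary, by contradiction, in the `G`-free currency `P S q := ∀ triples, rad ≤ S → c ≤ S^q`).
Normalise the crux (`submult_normalise`).  Suppose `¬ SGS`: some `ε > 0` and `N₀` such that every
scale `R ≥ N₀` carries a triple with `rad ≤ R`, `c > R^{1+ε}`.  Take `DroughtsOfSomeRatio (ε/2)`: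
a ratio `Λ > 1` and drought scales `R → ∞`.  Put `δ₁ := min (ε/12) ((Λ−1)/(4(Λ+2)))` and let `T`
be the threshold of `upper_propagation` for `δ₁`; call `(S, q)` ADMISSIBLE if `S ≥ R₀`,
`log S ≥ T`, `q ≥ 0` and `P S q`.
STEP (`step`): from an admissible `(S, q)`, `upper_propagation` bounds every triple by
`e^B rad^{q+2δ₁}`; at a large drought scale `R` the triples BELOW the window have
`c ≤ e^B R^{(q+2δ₁)/Λ} ≤ R^{m₁}`, `m₁ := (q+2δ₁)/Λ + δ₁`, so by `flat_of_drought`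
`P R (max m₁ (1+ε/2))`; but `R ≥ N₀` is `ε`-bad, which forces `m₁ > 1 + ε` — so `(R, m₁)` is
admissible, `m₁ > 1+ε`, and `q = Λ m₁ − (Λ+2) δ₁`.
ESCALATION (`key`, induction on `k`): every admissible `q` satisfies `q ≥ 1 + ε/2 + k (Λ−1)/2`
for every `k` (the step gains `(Λ−1) m₁ − (Λ+2)δ₁ ≥ (Λ−1)/2` since `m₁ ≥ 1`).
But abc.S25 (`finite_setOf_isABCTriple_primeFactors_subset_holds`, PROVED in the tree) makes some
`(S*, M)` admissible with a FIXED finite exponent `M` — contradiction for `k > 2M/(Λ−1)`.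
[folklore] -/
theorem sparseGoodScales_of_scaleSubmultiplicativity_of_droughts
    (hS : ScaleSubmultiplicativity) (hD : DroughtsOfSomeRatio) : SparseGoodScales := by
  classical
  obtain ⟨θ', hθ'1, K, hK, R₀', h⟩ := hS
  have hsub := FeketeScalesAssembly.submult_normalise hK h
  set θ : ℝ := max θ' 0 with hθ_def
  set L : ℝ := max (Real.log K) 0 with hL_def
  set R₀ : ℕ := max R₀' 2 with hR₀_def
  have hθ0 : 0 ≤ θ := le_max_right _ _
  have hθ1 : θ < 1 := max_lt hθ'1 one_pos
  have hL : 0 ≤ L := le_max_right _ _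
  have hR₀2 : 2 ≤ R₀ := le_max_right _ _
  by_contra hneg
  -- unpack `¬ SGS`
  have hneg' : ∃ ε : ℝ, 0 < ε ∧ ∃ N₀ : ℕ, ∀ R : ℕ, N₀ ≤ R →
      ∃ a b c : ℕ, IsABCTriple a b c ∧ rad a b c ≤ R ∧ (R : ℝ) ^ (1 + ε) < c := by
    unfold SparseGoodScales at hneg
    push Not at hneg
    obtain ⟨ε, hε, N₀, hN₀⟩ := hneg
    exact ⟨ε, hε, N₀, fun R hR => hN₀ R hR⟩
  obtain ⟨ε, hε, N₀, hbad⟩ := hneg'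
  -- droughts for quality `1 + ε/2`
  obtain ⟨Λ, hΛ1, hdr⟩ := hD (ε / 2) (by linarith)
  have hΛpos : 0 < Λ := by linarith
  -- the small parameter `δ₁`
  have h4 : 0 < 4 * (Λ + 2) := by linarith
  set δ₁ : ℝ := min (ε / 12) ((Λ - 1) / (4 * (Λ + 2))) with hδ₁_def
  have hδ₁pos : 0 < δ₁ := lt_min (by linarith) (div_pos (by linarith) h4)
  have hδ₁ε : δ₁ ≤ ε / 12 := min_le_left _ _
  have hδ₁Λ : (Λ + 2) * δ₁ ≤ (Λ - 1) / 4 := by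
    have h1 : δ₁ ≤ (Λ - 1) / (4 * (Λ + 2)) := min_le_right _ _
    rw [le_div_iff₀ h4] at h1
    linarith
  obtain ⟨T, hT⟩ := upper_propagation hθ0 hθ1 hL hsub hδ₁pos
  set c₀ : ℝ := (Λ - 1) / 2 with hc₀_def
  have hc₀pos : 0 < c₀ := by rw [hc₀_def]; linarith
  -- STEP: an admissible pair produces an admissible pair one window up, with escalated exponent
  have step : ∀ (S : ℕ) (q : ℝ), R₀ ≤ S → T ≤ Real.log S → 0 ≤ q →
      (∀ a b c : ℕ, IsABCTriple a b c → rad a b c ≤ S → (c : ℝ) ≤ (S : ℝ) ^ q) →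
      ∃ (R : ℕ) (m₁ : ℝ), R₀ ≤ R ∧ T ≤ Real.log R ∧ 1 + ε < m₁ ∧
        q = Λ * m₁ - (Λ + 2) * δ₁ ∧
        (∀ a b c : ℕ, IsABCTriple a b c → rad a b c ≤ R → (c : ℝ) ≤ (R : ℝ) ^ m₁) := by
    intro S q hR₀S hTS hq0 hP
    have hS2 : 2 ≤ S := hR₀2.trans hR₀S
    obtain ⟨B, hB⟩ := hT S q hR₀S hS2 hTS hq0 hP
    -- choose a large drought scale `R`
    set N₁ : ℕ := max (max R₀ N₀) (max ⌈Real.exp T⌉₊ ⌈Real.exp (B / δ₁)⌉₊) with hN₁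
    obtain ⟨R, hN₁R, hR⟩ := hdr N₁
    have hR₀R : R₀ ≤ R := ((le_max_left _ _).trans (le_max_left _ _)).trans hN₁R
    have hN₀R : N₀ ≤ R := ((le_max_right _ _).trans (le_max_left _ _)).trans hN₁R
    have hRT : ⌈Real.exp T⌉₊ ≤ R := ((le_max_left _ _).trans (le_max_right _ _)).trans hN₁R
    have hRB : ⌈Real.exp (B / δ₁)⌉₊ ≤ R :=
      ((le_max_right _ _).trans (le_max_right _ _)).trans hN₁R
    have hR2 : 2 ≤ R := hR₀2.trans hR₀R
    have hR1' : (1:ℝ) < R := by exact_mod_cast hR2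
    have hR1 : (1:ℝ) ≤ R := hR1'.le
    have hRpos : (0:ℝ) < R := by positivity
    have hlogT : T ≤ Real.log R := by
      have h1 : Real.exp T ≤ R := (Nat.le_ceil _).trans (by exact_mod_cast hRT)
      have := Real.log_le_log (Real.exp_pos T) h1
      rwa [Real.log_exp] at this
    have hlogB : B / δ₁ ≤ Real.log R := by
      have h1 : Real.exp (B / δ₁) ≤ R := (Nat.le_ceil _).trans (by exact_mod_cast hRB)
      have := Real.log_le_log (Real.exp_pos _) h1
      rwa [Real.log_exp] at this
    -- `e^B ≤ R^{δ₁}`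
    have heB : Real.exp B ≤ (R : ℝ) ^ δ₁ := by
      rw [Real.rpow_def_of_pos hRpos]
      apply Real.exp_le_exp.2
      have h1 := mul_le_mul_of_nonneg_right hlogB hδ₁pos.le
      rw [div_mul_cancel₀ _ hδ₁pos.ne'] at h1
      linarith [mul_comm (Real.log R) δ₁]
    set m₁ : ℝ := (q + 2 * δ₁) / Λ + δ₁ with hm₁_def
    have hexp0 : 0 ≤ (q + 2 * δ₁) / Λ := div_nonneg (by linarith) hΛpos.le
    -- below the window: `c ≤ R^{m₁}`
    have hbelow : ∀ a b c : ℕ, IsABCTriple a b c → ((rad a b c : ℕ) : ℝ) ^ Λ ≤ R →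
        (c : ℝ) ≤ (R : ℝ) ^ m₁ := by
      intro a b c habc hle
      have hrad0 : (0:ℝ) ≤ ((rad a b c : ℕ) : ℝ) := Nat.cast_nonneg _
      have h1 : (c : ℝ) ≤ Real.exp B * ((rad a b c : ℕ) : ℝ) ^ (q + 2 * δ₁) := hB a b c habc
      have h2 : ((rad a b c : ℕ) : ℝ) ^ (q + 2 * δ₁) ≤ (R : ℝ) ^ ((q + 2 * δ₁) / Λ) := by
        have e : ((rad a b c : ℕ) : ℝ) ^ (q + 2 * δ₁) =
            (((rad a b c : ℕ) : ℝ) ^ Λ) ^ ((q + 2 * δ₁) / Λ) := by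
          rw [← Real.rpow_mul hrad0]
          congr 1
          field_simp
        rw [e]
        exact Real.rpow_le_rpow (Real.rpow_nonneg hrad0 _) hle hexp0
      have h3 : Real.exp B * ((rad a b c : ℕ) : ℝ) ^ (q + 2 * δ₁) ≤
          (R : ℝ) ^ δ₁ * (R : ℝ) ^ ((q + 2 * δ₁) / Λ) :=
        mul_le_mul heB h2 (Real.rpow_nonneg hrad0 _) (Real.rpow_nonneg hRpos.le _)
      have h4 : (R : ℝ) ^ δ₁ * (R : ℝ) ^ ((q + 2 * δ₁) / Λ) = (R : ℝ) ^ m₁ := by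
        rw [← Real.rpow_add hRpos, hm₁_def]
        congr 1; ring
      exact (h1.trans h3).trans h4.le
    -- flatness at the drought scale
    have hflat := flat_of_drought (δ := ε / 2) (Λ := Λ) (Y := (R : ℝ) ^ m₁) (R := R)
      (by linarith) hR hbelow
    set m : ℝ := max m₁ (1 + ε / 2) with hm_def
    have hPm : ∀ a b c : ℕ, IsABCTriple a b c → rad a b c ≤ R → (c : ℝ) ≤ (R : ℝ) ^ m := by
      intro a b c habc hrad
      refine (hflat a b c habc hrad).trans (max_le ?_ ?_)
      · exact Real.rpow_le_rpow_of_exponent_le hR1 (le_max_left _ _)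
      · exact Real.rpow_le_rpow_of_exponent_le hR1 (le_max_right _ _)
    -- `R ≥ N₀` is `ε`-bad, which forces the first branch of the max
    obtain ⟨a, b, c, habc, hrad, hlt⟩ := hbad R hN₀R
    have hcm : (c : ℝ) ≤ (R : ℝ) ^ m := hPm a b c habc hrad
    have hεm : 1 + ε < m := by
      have := hlt.trans_le hcm
      exact (Real.rpow_lt_rpow_left_iff hR1').1 this
    have hm₁ : 1 + ε < m₁ := by
      rcases lt_max_iff.1 hεm with h1 | h1
      · exact h1
      · linarith
    have hmm₁ : m = m₁ := max_eq_left (by linarith)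
    refine ⟨R, m₁, hR₀R, hlogT, hm₁, ?_, ?_⟩
    · rw [hm₁_def]; field_simp; ring
    · intro a b c habc hrad
      have := hPm a b c habc hrad
      rwa [hmm₁] at this
  -- ESCALATION: every admissible exponent is `≥ 1 + ε/2 + k c₀`, for every `k`
  have key : ∀ k : ℕ, ∀ (S : ℕ) (q : ℝ), R₀ ≤ S → T ≤ Real.log S → 0 ≤ q →
      (∀ a b c : ℕ, IsABCTriple a b c → rad a b c ≤ S → (c : ℝ) ≤ (S : ℝ) ^ q) →
      1 + ε / 2 + k * c₀ ≤ q := by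
    intro k
    induction k with
    | zero =>
      intro S q h1 h2 h3 h4
      obtain ⟨R, m₁, -, -, hm₁, hq, -⟩ := step S q h1 h2 h3 h4
      have hprod : Λ * (1 + ε) ≤ Λ * m₁ := mul_le_mul_of_nonneg_left hm₁.le hΛpos.le
      have hnn : 0 ≤ (Λ - 1) * (ε + 3 / 4) := mul_nonneg (by linarith) (by linarith)
      have e : Λ * (1 + ε) = (1 + ε) + (Λ - 1) * (ε + 3 / 4) + (Λ - 1) / 4 := by ring
      simp only [Nat.cast_zero, zero_mul, add_zero]
      linarith
    | succ k ih =>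
      intro S q h1 h2 h3 h4
      obtain ⟨R, m₁, hR₀R, hTR, hm₁, hq, hPR⟩ := step S q h1 h2 h3 h4
      have hm₁0 : 0 ≤ m₁ := by linarith
      have hIH := ih R m₁ hR₀R hTR hm₁0 hPR
      have hm₁1 : 1 ≤ m₁ := by linarith
      have hprod : (Λ - 1) * 1 ≤ (Λ - 1) * m₁ := mul_le_mul_of_nonneg_left hm₁1 (by linarith)
      have e : Λ * m₁ = m₁ + (Λ - 1) * m₁ := by ring
      push_cast
      rw [hq]
      linarith
  -- an admissible pair with a FIXED exponent, from abc.S25 (proved): contradiction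
  set Sstar : ℕ := max R₀ ⌈Real.exp T⌉₊ with hSstar
  have hR₀S : R₀ ≤ Sstar := le_max_left _ _
  have hS2 : 2 ≤ Sstar := hR₀2.trans hR₀S
  have hSpos : (0:ℝ) < Sstar := by positivity
  have hST : T ≤ Real.log Sstar := by
    have h1 : Real.exp T ≤ Sstar :=
      (Nat.le_ceil _).trans (by exact_mod_cast (le_max_right _ _ : ⌈Real.exp T⌉₊ ≤ Sstar))
    have := Real.log_le_log (Real.exp_pos T) h1
    rwa [Real.log_exp] at this
  obtain ⟨M, hM⟩ := feketeScales_exists_bound_of_rad_le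
    finite_setOf_isABCTriple_primeFactors_subset_holds Sstar
  have hPstar : ∀ a b c : ℕ, IsABCTriple a b c → rad a b c ≤ Sstar →
      (c : ℝ) ≤ (Sstar : ℝ) ^ (M : ℝ) := by
    intro a b c habc hrad
    have h1 : (c : ℝ) ≤ M := by exact_mod_cast hM a b c habc hrad
    have h2 : (M : ℝ) ≤ (2 : ℝ) ^ M := by exact_mod_cast (Nat.lt_two_pow_self).le
    have h3 : (2 : ℝ) ^ M ≤ (Sstar : ℝ) ^ M := pow_le_pow_left₀ (by norm_num) (by exact_mod_cast hS2) M
    rw [Real.rpow_natCast]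
    linarith
  obtain ⟨k, hk⟩ := exists_nat_gt ((M : ℝ) / c₀)
  have hkey := key k Sstar M hR₀S hST (Nat.cast_nonneg M) hPstar
  have hkc : (M : ℝ) < k * c₀ := by
    rw [div_lt_iff₀ hc₀pos] at hk
    linarith
  linarith

/-- In-route logical position of DA∃: under the rank-2 crux, `DroughtsOfSomeRatio ↔
SparseGoodScales` (hence, with the landed `sparseGoodScales_iff_abc_of_scaleSubmultiplicativity`,
`↔ ABC ↔ WGS ↔ DA`). [folklore] -/
theorem droughtsOfSomeRatio_iff_sparseGoodScales_of_scaleSubmultiplicativity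
    (hS : ScaleSubmultiplicativity) : DroughtsOfSomeRatio ↔ SparseGoodScales :=
  ⟨sparseGoodScales_of_scaleSubmultiplicativity_of_droughts hS,
    droughtsOfSomeRatio_of_sparseGoodScales⟩

end Summit.ABC.ABC.Cruxes.SparseGoodScales.MinimalResidue
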